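import Summits.QuantumFields.YangMills.Theorems.ColdStartUniversalityLatticeLangevinWilsonSpectralGap
import Mathlib.MeasureTheory.Function.ContinuousMapDense
import HarnessLib

/-!
# Route `ColdStartUniversality` (fixed-cut-off `L²(μ_{β'})` package): the spectral gap on BOUNDED MEASURABLE observables and
# on EVENTS — `(P(U_{t₁+t} ∈ A) − μ(A))² ≤ D e^{-2ct} μ(A)(1 − μ(A))`

Helper file (seat `ym-line-csu-p1`, g16), sequel of `…WilsonSpectralGap` / `…WilsonSpectralGapColdStart`.  The variance decay
`∫ (κ_t F − μF)² dμ ≤ e^{-2ct} Var_μ(F)` of `wilson_spectralGap` is stated there for CONTINUOUS `F` (the log-convexity argument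
runs through the Feller property); here it is extended to bounded measurable `F` by density of `C(SU(2)^E)` in `L²(μ)`
(`MemLp.exists_boundedContinuous_integral_rpow_sub_le`; the configuration space is compact metrisable, `μ` is a finite Borel
measure) and the `L²(μ)`-contraction of the kernels (`integral_sq_transition_le`):

* `sqrt_integral_add_sq_le` — Minkowski in `L²` for bounded measurable functions (from the tree's Cauchy–Schwarz);
* `exists_continuous_integral_sub_sq_le` — density of continuous functions in `L²(μ)` on the configuration space;
* ★ `integral_sq_transition_sub_le_exp_of_measurable` — THE BRIDGE: a variance-decay rate valid for all continuous observables is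
  valid, with the same constant, for all bounded measurable ones;
* ★ `wilson_spectralGap_measurable` — `∃ c > 0`: for every realising kernel family, every bounded measurable `F`, every `t`,
  `∫ (κ_t F − μF)² dμ_{β'} ≤ e^{-2ct} ∫ (F − μF)² dμ_{β'}`; in particular for an EVENT `A`,
  `∫ (κ_t(x, A) − μ(A))² dμ(x) ≤ e^{-2ct} μ(A)(1 − μ(A))`;
* ★ `coldStart_measure_sq_sub_le_exp` — from a deterministic start `z` after a burn-in `t₁ > 0` (density bound `D`):
  `(P(U_{t₁+t} ∈ A) − μ(A))² ≤ D e^{-2ct} μ(A)(1 − μ(A))` for every measurable `A`, every solution from `z` on any space — a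
  RELATIVE error bound (rare events under `μ_{β'}` are rarely hit), which the sup-norm Harris bound `exp_mixing_szz` cannot give.

THEOREMS ONLY, no definition, no sorry.  HONEST FRAMING: fixed-cut-off plumbing (`c, D` depend on `L, β'` and on `z, t₁`);
no rung, crux or summit statement is proved; the Yang–Mills mass gap is NOT proved.
-/

set_option autoImplicit false

noncomputable section

namespace Summit.QuantumFields.YangMills.Theorems.ColdStartUniversality

open MeasureTheory ProbabilityTheory Finset Filter Set Topology
open scoped BigOperators NNReal ENNReal
open Literature.Probability.Process Literature.MathematicalPhysics.QuantumFieldTheory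
open Literature.MathematicalPhysics.QuantumLattice (fundamentalRep fundamentalLatticeRep continuous_fundamentalRep)

variable {L : ℕ} [NeZero L]

/-! ## `L²` tools for bounded measurable functions -/

/-- A bounded measurable real function is integrable against a finite measure. [folklore] -/
theorem integrable_of_abs_le {Y : Type*} [MeasurableSpace Y] (ν : Measure Y) [IsFiniteMeasure ν]
    {u : Y → ℝ} (hu : Measurable u) {C : ℝ} (hC : ∀ y, |u y| ≤ C) : Integrable u ν :=
  (integrable_const C).mono' hu.aestronglyMeasurable (ae_of_all _ fun y => by rw [Real.norm_eq_abs]; exact hC y)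

/-- **Minkowski in `L²`** for bounded measurable real functions against a finite measure:
`√∫(a+b)² ≤ √∫a² + √∫b²` (from Cauchy–Schwarz `sq_integral_mul_le_integral_sq_mul`). [folklore] -/
theorem sqrt_integral_add_sq_le {Y : Type*} [MeasurableSpace Y] (ν : Measure Y) [IsFiniteMeasure ν]
    {a b : Y → ℝ} (ham : Measurable a) (hbm : Measurable b) {Ca Cb : ℝ} (ha : ∀ y, |a y| ≤ Ca) (hb : ∀ y, |b y| ≤ Cb) :
    Real.sqrt (∫ y, (a y + b y) ^ 2 ∂ν) ≤ Real.sqrt (∫ y, (a y) ^ 2 ∂ν) + Real.sqrt (∫ y, (b y) ^ 2 ∂ν) := by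
  have ha2 : Integrable (fun y => (a y) ^ 2) ν :=
    integrable_of_abs_le ν (ham.pow_const 2) (C := Ca ^ 2) fun y => by
      rw [abs_pow]; exact pow_le_pow_left₀ (abs_nonneg _) (ha y) 2
  have hb2 : Integrable (fun y => (b y) ^ 2) ν :=
    integrable_of_abs_le ν (hbm.pow_const 2) (C := Cb ^ 2) fun y => by
      rw [abs_pow]; exact pow_le_pow_left₀ (abs_nonneg _) (hb y) 2
  have hab : Integrable (fun y => a y * b y) ν :=
    integrable_of_abs_le ν (ham.mul hbm) (C := Ca * Cb) fun y => by
      rw [abs_mul]; exact mul_le_mul (ha y) (hb y) (abs_nonneg _) ((abs_nonneg _).trans (ha y))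
  set A : ℝ := ∫ y, (a y) ^ 2 ∂ν with hA
  set B : ℝ := ∫ y, (b y) ^ 2 ∂ν with hB
  set P : ℝ := ∫ y, a y * b y ∂ν with hP
  have hA0 : 0 ≤ A := integral_nonneg fun y => sq_nonneg _
  have hB0 : 0 ≤ B := integral_nonneg fun y => sq_nonneg _
  have hCS : P ^ 2 ≤ A * B := sq_integral_mul_le_integral_sq_mul ν ham hbm ha hb
  have hexp : ∫ y, (a y + b y) ^ 2 ∂ν = A + 2 * P + B := by
    have e : ∀ y, (a y + b y) ^ 2 = (a y) ^ 2 + 2 * (a y * b y) + (b y) ^ 2 := fun y => by ring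
    simp_rw [e]
    have h2ab : Integrable (fun y => 2 * (a y * b y)) ν := hab.const_mul 2
    have h12 : Integrable (fun y => (a y) ^ 2 + 2 * (a y * b y)) ν := ha2.add h2ab
    rw [integral_add h12 hb2, integral_add ha2 h2ab, integral_const_mul]
  have hPle : P ≤ Real.sqrt A * Real.sqrt B := by
    rw [← Real.sqrt_mul hA0]
    exact (le_abs_self P).trans (Real.abs_le_sqrt hCS)
  have hsum : ∫ y, (a y + b y) ^ 2 ∂ν ≤ (Real.sqrt A + Real.sqrt B) ^ 2 := by
    rw [hexp, add_sq, Real.sq_sqrt hA0, Real.sq_sqrt hB0]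
    linarith
  calc Real.sqrt (∫ y, (a y + b y) ^ 2 ∂ν) ≤ Real.sqrt ((Real.sqrt A + Real.sqrt B) ^ 2) := Real.sqrt_le_sqrt hsum
    _ = Real.sqrt A + Real.sqrt B := Real.sqrt_sq (add_nonneg (Real.sqrt_nonneg _) (Real.sqrt_nonneg _))

/-- **Continuous functions are dense in `L²(μ)` on the configuration space** (compact metrisable, `μ` a finite Borel measure):
a bounded measurable `F` is within `ε` of a continuous function in mean square. [folklore] -/
theorem exists_continuous_integral_sub_sq_le (μ : Measure (GaugeConfig 3 L (Matrix.specialUnitaryGroup (Fin 2) ℂ)))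
    [IsFiniteMeasure μ] {F : GaugeConfig 3 L (Matrix.specialUnitaryGroup (Fin 2) ℂ) → ℝ} (hF : Measurable F)
    {M : ℝ} (hM : ∀ x, |F x| ≤ M) {ε : ℝ} (hε : 0 < ε) :
    ∃ G : GaugeConfig 3 L (Matrix.specialUnitaryGroup (Fin 2) ℂ) → ℝ, Continuous G ∧ ∫ x, (F x - G x) ^ 2 ∂μ ≤ ε := by
  haveI := secondCountableTopology_su2
  haveI := borelSpace_config L
  have hLp : MemLp F (ENNReal.ofReal 2) μ :=
    MemLp.of_bound hF.aestronglyMeasurable M (ae_of_all _ fun x => by rw [Real.norm_eq_abs]; exact hM x)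
  obtain ⟨g, hg, -⟩ := hLp.exists_boundedContinuous_integral_rpow_sub_le two_pos hε
  refine ⟨g, g.continuous, ?_⟩
  have e : ∀ x, (F x - g x) ^ 2 = ‖F x - g x‖ ^ (2 : ℝ) := fun x => by
    rw [Real.rpow_two, Real.norm_eq_abs, sq_abs]
  simp_rw [e]
  exact hg

/-! ## The bridge: continuous ⇒ bounded measurable -/

/-- ★ **Variance decay extends from continuous to bounded measurable observables.**  Let `κ` realise the SZZ transition laws at
`β'` and suppose that at the lattice time `t`, `∫ (κ_t G − μG)² dμ_{β'} ≤ e^{-2ct} ∫ (G − μG)² dμ_{β'}` for every CONTINUOUS `G`.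
Then the same holds for every bounded measurable `F` (density of `C(SU(2)^E)` in `L²(μ_{β'})`, Minkowski, and the
`L²(μ_{β'})`-contraction `integral_sq_transition_le` of `κ_t` on the error `F − G`). [cite: RobertsRosenthal1997, Theorem 2.1] -/
theorem integral_sq_transition_sub_le_exp_of_measurable (L : ℕ) [NeZero L] (β' : ℝ)
    (κ : ℝ≥0 → Kernel (GaugeConfig 3 L (Matrix.specialUnitaryGroup (Fin 2) ℂ))
      (GaugeConfig 3 L (Matrix.specialUnitaryGroup (Fin 2) ℂ))) [∀ t, IsMarkovKernel (κ t)]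
    (hreal : ∀ (t : ℝ≥0) (x : GaugeConfig 3 L (Matrix.specialUnitaryGroup (Fin 2) ℂ))
        (Ω : Type) [MeasurableSpace Ω] (P : Measure Ω) [IsProbabilityMeasure P]
        (W : ℝ≥0 → Ω → (Edge 3 L × NoiseIdx 2 → ℝ)) (hW : IsFlatBrownian W P)
        (U : ℝ≥0 → Ω → GaugeConfig 3 L (Matrix.specialUnitaryGroup (Fin 2) ℂ)),
        (∀ ω, U 0 ω = x) →
        (latticeLangevinDynamics (fundamentalLatticeRep 2) β').IsSolution (fundamentalRep (Fin 2))
          hW.natFiltration P W U →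
        κ t x = P.map (U t))
    {c : ℝ} {t : ℝ≥0}
    (hvar : ∀ G : GaugeConfig 3 L (Matrix.specialUnitaryGroup (Fin 2) ℂ) → ℝ, Continuous G →
      ∫ x, ((∫ y, G y ∂(κ t x)) - ∫ z, G z ∂(wilsonMeasure (d := 3) (L := L) (fundamentalRep (Fin 2)) β')) ^ 2
          ∂(wilsonMeasure (d := 3) (L := L) (fundamentalRep (Fin 2)) β') ≤
        Real.exp (-2 * c * t) *
          ∫ x, (G x - ∫ z, G z ∂(wilsonMeasure (d := 3) (L := L) (fundamentalRep (Fin 2)) β')) ^ 2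
            ∂(wilsonMeasure (d := 3) (L := L) (fundamentalRep (Fin 2)) β'))
    {F : GaugeConfig 3 L (Matrix.specialUnitaryGroup (Fin 2) ℂ) → ℝ} (hF : Measurable F) {M : ℝ} (hM : ∀ x, |F x| ≤ M) :
    ∫ x, ((∫ y, F y ∂(κ t x)) - ∫ z, F z ∂(wilsonMeasure (d := 3) (L := L) (fundamentalRep (Fin 2)) β')) ^ 2
        ∂(wilsonMeasure (d := 3) (L := L) (fundamentalRep (Fin 2)) β') ≤
      Real.exp (-2 * c * t) *
        ∫ x, (F x - ∫ z, F z ∂(wilsonMeasure (d := 3) (L := L) (fundamentalRep (Fin 2)) β')) ^ 2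
          ∂(wilsonMeasure (d := 3) (L := L) (fundamentalRep (Fin 2)) β') := by
  classical
  haveI := secondCountableTopology_su2
  haveI := borelSpace_config L
  set μ : Measure (GaugeConfig 3 L (Matrix.specialUnitaryGroup (Fin 2) ℂ)) :=
    wilsonMeasure (d := 3) (L := L) (fundamentalRep (Fin 2)) β' with hμ
  haveI : IsProbabilityMeasure μ :=
    isProbabilityMeasure_wilsonMeasure (d := 3) (L := L) (fundamentalRep (Fin 2)) (continuous_fundamentalRep (Fin 2)) β'
  -- notation: `V H = ∫ (H − μH)²`, `Wt H = ∫ (κ_t H − μH)²`, `r = e^{-ct}`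
  set r : ℝ := Real.exp (-c * t) with hr
  have hrpos : 0 < r := Real.exp_pos _
  have hr2 : Real.exp (-2 * c * t) = r ^ 2 := by
    rw [hr, ← Real.exp_nat_mul]; congr 1; push_cast; ring
  -- kernel images of bounded measurable functions are bounded measurable
  have hκm : ∀ {H : GaugeConfig 3 L (Matrix.specialUnitaryGroup (Fin 2) ℂ) → ℝ}, Measurable H →
      Measurable (fun x => ∫ y, H y ∂(κ t x)) := fun hH =>
    (hH.stronglyMeasurable.integral_kernel (κ := κ t)).measurable
  have hκb : ∀ {H : GaugeConfig 3 L (Matrix.specialUnitaryGroup (Fin 2) ℂ) → ℝ} {C : ℝ}, (∀ x, |H x| ≤ C) →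
      ∀ x, |∫ y, H y ∂(κ t x)| ≤ C := fun hC x => abs_integral_le_of_abs_le_of_isProbabilityMeasure hC
  have hμb : ∀ {H : GaugeConfig 3 L (Matrix.specialUnitaryGroup (Fin 2) ℂ) → ℝ} {C : ℝ}, (∀ x, |H x| ≤ C) →
      |∫ z, H z ∂μ| ≤ C := fun hC => abs_integral_le_of_abs_le_of_isProbabilityMeasure hC
  -- the three functionals on bounded measurable `H`: `W H ≤ V H ≤ ∫ H²`
  have hWV : ∀ {H : GaugeConfig 3 L (Matrix.specialUnitaryGroup (Fin 2) ℂ) → ℝ}, Measurable H → ∀ {C : ℝ}, (∀ x, |H x| ≤ C) →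
      ∫ x, ((∫ y, H y ∂(κ t x)) - ∫ z, H z ∂μ) ^ 2 ∂μ ≤ ∫ x, (H x - ∫ z, H z ∂μ) ^ 2 ∂μ := by
    intro H hH C hC
    set m : ℝ := ∫ z, H z ∂μ with hm
    have hHc : Measurable fun x => H x - m := hH.sub measurable_const
    have hHcb : ∀ x, |H x - m| ≤ C + C := fun x =>
      (abs_sub _ _).trans (add_le_add (hC x) (hμb hC))
    have e : ∀ x, (∫ y, H y ∂(κ t x)) - m = ∫ y, (H y - m) ∂(κ t x) := by
      intro x
      rw [integral_sub (integrable_of_abs_le _ hH hC) (integrable_const m)]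
      simp
    simp_rw [e]
    exact integral_sq_transition_le L β' κ hreal t hHc ⟨C + C, hHcb⟩
  have hV2 : ∀ {H : GaugeConfig 3 L (Matrix.specialUnitaryGroup (Fin 2) ℂ) → ℝ}, Measurable H → ∀ {C : ℝ}, (∀ x, |H x| ≤ C) →
      ∫ x, (H x - ∫ z, H z ∂μ) ^ 2 ∂μ ≤ ∫ x, (H x) ^ 2 ∂μ := by
    intro H hH C hC
    have hLp : MemLp H 2 μ :=
      MemLp.of_bound hH.aestronglyMeasurable C (ae_of_all _ fun x => by rw [Real.norm_eq_abs]; exact hC x)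
    have hvar : variance H μ = ∫ x, (H x - ∫ z, H z ∂μ) ^ 2 ∂μ := variance_eq_integral hH.aemeasurable
    rw [← hvar, variance_eq_sub hLp]
    have h2 : μ[H ^ 2] = ∫ x, (H x) ^ 2 ∂μ := rfl
    rw [h2]
    linarith [sq_nonneg (μ[H])]
  -- `√W F ≤ r √V F + ε` for every `ε > 0`
  set V : ℝ := ∫ x, (F x - ∫ z, F z ∂μ) ^ 2 ∂μ with hVdef
  set Wt : ℝ := ∫ x, ((∫ y, F y ∂(κ t x)) - ∫ z, F z ∂μ) ^ 2 ∂μ with hWdef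
  have hV0 : 0 ≤ V := integral_nonneg fun x => sq_nonneg _
  have hW0 : 0 ≤ Wt := integral_nonneg fun x => sq_nonneg _
  have hkey : ∀ ε : ℝ, 0 < ε → Real.sqrt Wt ≤ r * Real.sqrt V + ε := by
    intro ε hε
    -- a continuous `G` with `‖F − G‖₂ ≤ δ`, `δ = ε/(r+1)`
    set δ : ℝ := ε / (r + 1) with hδ
    have hδpos : 0 < δ := div_pos hε (by linarith)
    obtain ⟨G, hGc, hGF⟩ := exists_continuous_integral_sub_sq_le (L := L) μ hF hM (pow_pos hδpos 2)
    obtain ⟨MG, -, hMG⟩ := exists_abs_le_of_continuous hGc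
    -- the error `H = F − G`
    have hHm : Measurable fun x => F x - G x := hF.sub hGc.measurable
    have hHb : ∀ x, |F x - G x| ≤ M + MG := fun x => (abs_sub _ _).trans (add_le_add (hM x) (hMG x))
    have hsqH : Real.sqrt (∫ x, ((F x - G x) - ∫ z, (F z - G z) ∂μ) ^ 2 ∂μ) ≤ δ := by
      refine (Real.sqrt_le_sqrt ((hV2 hHm hHb).trans hGF)).trans ?_
      rw [Real.sqrt_sq hδpos.le]
    have hsqWH : Real.sqrt (∫ x, ((∫ y, (F y - G y) ∂(κ t x)) - ∫ z, (F z - G z) ∂μ) ^ 2 ∂μ) ≤ δ :=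
      (Real.sqrt_le_sqrt (hWV hHm hHb)).trans hsqH
    -- `√W G ≤ r √V G` (the hypothesis on continuous `G`)
    have hsqWG : Real.sqrt (∫ x, ((∫ y, G y ∂(κ t x)) - ∫ z, G z ∂μ) ^ 2 ∂μ) ≤
        r * Real.sqrt (∫ x, (G x - ∫ z, G z ∂μ) ^ 2 ∂μ) := by
      have h := hvar G hGc
      rw [hr2] at h
      calc Real.sqrt (∫ x, ((∫ y, G y ∂(κ t x)) - ∫ z, G z ∂μ) ^ 2 ∂μ)
          ≤ Real.sqrt (r ^ 2 * ∫ x, (G x - ∫ z, G z ∂μ) ^ 2 ∂μ) := Real.sqrt_le_sqrt h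
        _ = r * Real.sqrt (∫ x, (G x - ∫ z, G z ∂μ) ^ 2 ∂μ) := by
            rw [Real.sqrt_mul (sq_nonneg r), Real.sqrt_sq hrpos.le]
    -- Minkowski twice: `√V G ≤ √V F + δ` and `√W F ≤ √W G + √W H`
    have hVG : Real.sqrt (∫ x, (G x - ∫ z, G z ∂μ) ^ 2 ∂μ) ≤ Real.sqrt V + δ := by
      have e : ∀ x, G x - ∫ z, G z ∂μ = (F x - ∫ z, F z ∂μ) + (-((F x - G x) - ∫ z, (F z - G z) ∂μ)) := by
        intro x
        rw [integral_sub (integrable_of_abs_le μ hF hM) (integrable_of_abs_le μ hGc.measurable hMG)]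
        ring
      simp_rw [e]
      have hbm : Measurable fun x => -((F x - G x) - ∫ z, (F z - G z) ∂μ) := (hHm.sub measurable_const).neg
      refine (sqrt_integral_add_sq_le μ (hF.sub measurable_const) hbm
        (Ca := M + M) (Cb := (M + MG) + (M + MG)) (fun x => (abs_sub _ _).trans (add_le_add (hM x) (hμb hM)))
        (fun x => by
          show |-((F x - G x) - ∫ z, (F z - G z) ∂μ)| ≤ (M + MG) + (M + MG)
          rw [abs_neg]; exact (abs_sub _ _).trans (add_le_add (hHb x) (hμb hHb)))).trans ?_
      have e2 : ∀ x, (-((F x - G x) - ∫ z, (F z - G z) ∂μ)) ^ 2 = ((F x - G x) - ∫ z, (F z - G z) ∂μ) ^ 2 :=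
        fun x => neg_sq _
      simp_rw [e2]
      exact add_le_add le_rfl hsqH
    have hWF : Real.sqrt Wt ≤ Real.sqrt (∫ x, ((∫ y, G y ∂(κ t x)) - ∫ z, G z ∂μ) ^ 2 ∂μ) +
        Real.sqrt (∫ x, ((∫ y, (F y - G y) ∂(κ t x)) - ∫ z, (F z - G z) ∂μ) ^ 2 ∂μ) := by
      have e : ∀ x, (∫ y, F y ∂(κ t x)) - ∫ z, F z ∂μ =
          ((∫ y, G y ∂(κ t x)) - ∫ z, G z ∂μ) + ((∫ y, (F y - G y) ∂(κ t x)) - ∫ z, (F z - G z) ∂μ) := by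
        intro x
        rw [integral_sub (integrable_of_abs_le _ hF hM) (integrable_of_abs_le _ hGc.measurable hMG),
          integral_sub (integrable_of_abs_le μ hF hM) (integrable_of_abs_le μ hGc.measurable hMG)]
        ring
      rw [hWdef]
      simp_rw [e]
      exact sqrt_integral_add_sq_le μ ((hκm hGc.measurable).sub measurable_const) ((hκm hHm).sub measurable_const)
        (Ca := MG + MG) (Cb := (M + MG) + (M + MG))
        (fun x => (abs_sub _ _).trans (add_le_add (hκb hMG x) (hμb hMG)))
        (fun x => (abs_sub _ _).trans (add_le_add (hκb hHb x) (hμb hHb)))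
    -- assemble
    have hfin : r * (Real.sqrt V + δ) + δ = r * Real.sqrt V + ε := by
      rw [hδ]; field_simp; ring
    calc Real.sqrt Wt ≤ r * (Real.sqrt V + δ) + δ := by
          nlinarith [hWF, hsqWG, hsqWH, hVG, hrpos.le]
      _ = r * Real.sqrt V + ε := hfin
  have hsq : Real.sqrt Wt ≤ r * Real.sqrt V := le_of_forall_pos_le_add hkey
  have h1 : Wt = Real.sqrt Wt ^ 2 := (Real.sq_sqrt hW0).symm
  rw [hr2, h1, show r ^ 2 * V = (r * Real.sqrt V) ^ 2 by rw [mul_pow, Real.sq_sqrt hV0]]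
  exact pow_le_pow_left₀ (Real.sqrt_nonneg _) hsq 2


/-! ## The spectral gap on bounded measurable observables and on events -/

/-- The variance of an indicator: `∫ (1_A − μ(A))² dμ = μ(A)(1 − μ(A))` for a probability measure. [folklore] -/
theorem integral_indicator_sub_sq {Y : Type*} [MeasurableSpace Y] (ν : Measure Y) [IsProbabilityMeasure ν]
    {A : Set Y} (hA : MeasurableSet A) :
    ∫ y, (A.indicator (1 : Y → ℝ) y - ν.real A) ^ 2 ∂ν = ν.real A * (1 - ν.real A) := by
  set p : ℝ := ν.real A with hp
  have e : ∀ y, (A.indicator (1 : Y → ℝ) y - p) ^ 2 = (1 - 2 * p) * A.indicator (1 : Y → ℝ) y + p ^ 2 := by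
    intro y
    by_cases hy : y ∈ A
    · simp [Set.indicator_of_mem hy]; ring
    · simp [Set.indicator_of_notMem hy]
  simp_rw [e]
  have hi : Integrable (A.indicator (1 : Y → ℝ)) ν := (integrable_const (1 : ℝ)).indicator hA
  rw [integral_add (hi.const_mul _) (integrable_const _), integral_const_mul,
    integral_indicator_one hA, integral_const, smul_eq_mul, probReal_univ, one_mul, ← hp]
  ring

/-- ★ **The `L²(μ_{β'})` spectral gap on bounded measurable observables and on events.**  There is `c > 0` (the Doeblin rate)
such that for every Markov kernel family realising the SZZ transition laws at `β'`: for every bounded measurable `F` and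
every lattice time `t`, `∫ (κ_t F − μF)² dμ_{β'} ≤ e^{-2ct} ∫ (F − μF)² dμ_{β'}`; and for every event `A`,
`∫ (κ_t(x, A) − μ(A))² dμ_{β'}(x) ≤ e^{-2ct} μ(A)(1 − μ(A))`. [cite: RobertsRosenthal1997, Theorem 2.1] -/
theorem wilson_spectralGap_measurable (L : ℕ) [NeZero L] (β' : ℝ) :
    ∃ c : ℝ, 0 < c ∧
      ∀ (κ : ℝ≥0 → Kernel (GaugeConfig 3 L (Matrix.specialUnitaryGroup (Fin 2) ℂ))
          (GaugeConfig 3 L (Matrix.specialUnitaryGroup (Fin 2) ℂ))) [∀ t, IsMarkovKernel (κ t)],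
        (∀ (t : ℝ≥0) (x : GaugeConfig 3 L (Matrix.specialUnitaryGroup (Fin 2) ℂ))
          (Ω : Type) [MeasurableSpace Ω] (P : Measure Ω) [IsProbabilityMeasure P]
          (W : ℝ≥0 → Ω → (Edge 3 L × NoiseIdx 2 → ℝ)) (hW : IsFlatBrownian W P)
          (U : ℝ≥0 → Ω → GaugeConfig 3 L (Matrix.specialUnitaryGroup (Fin 2) ℂ)),
          (∀ ω, U 0 ω = x) →
          (latticeLangevinDynamics (fundamentalLatticeRep 2) β').IsSolution (fundamentalRep (Fin 2))
            hW.natFiltration P W U →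
          κ t x = P.map (U t)) →
        (∀ (F : GaugeConfig 3 L (Matrix.specialUnitaryGroup (Fin 2) ℂ) → ℝ), Measurable F →
          ∀ M : ℝ, (∀ x, |F x| ≤ M) → ∀ t : ℝ≥0,
          ∫ x, ((∫ y, F y ∂(κ t x)) - ∫ z, F z ∂(wilsonMeasure (d := 3) (L := L) (fundamentalRep (Fin 2)) β')) ^ 2
              ∂(wilsonMeasure (d := 3) (L := L) (fundamentalRep (Fin 2)) β') ≤
            Real.exp (-2 * c * t) *
              ∫ x, (F x - ∫ z, F z ∂(wilsonMeasure (d := 3) (L := L) (fundamentalRep (Fin 2)) β')) ^ 2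
                ∂(wilsonMeasure (d := 3) (L := L) (fundamentalRep (Fin 2)) β')) ∧
        (∀ (A : Set (GaugeConfig 3 L (Matrix.specialUnitaryGroup (Fin 2) ℂ))), MeasurableSet A → ∀ t : ℝ≥0,
          ∫ x, ((κ t x).real A - (wilsonMeasure (d := 3) (L := L) (fundamentalRep (Fin 2)) β').real A) ^ 2
              ∂(wilsonMeasure (d := 3) (L := L) (fundamentalRep (Fin 2)) β') ≤
            Real.exp (-2 * c * t) * ((wilsonMeasure (d := 3) (L := L) (fundamentalRep (Fin 2)) β').real A *
              (1 - (wilsonMeasure (d := 3) (L := L) (fundamentalRep (Fin 2)) β').real A))) := by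
  classical
  haveI := secondCountableTopology_su2
  haveI := borelSpace_config L
  haveI : IsProbabilityMeasure (wilsonMeasure (d := 3) (L := L) (fundamentalRep (Fin 2)) β') :=
    isProbabilityMeasure_wilsonMeasure (d := 3) (L := L) (fundamentalRep (Fin 2)) (continuous_fundamentalRep (Fin 2)) β'
  obtain ⟨c, hc, hgap⟩ := wilson_spectralGap L β'
  refine ⟨c, hc, fun κ _ hreal => ?_⟩
  have hmeas : ∀ (F : GaugeConfig 3 L (Matrix.specialUnitaryGroup (Fin 2) ℂ) → ℝ), Measurable F →
      ∀ M : ℝ, (∀ x, |F x| ≤ M) → ∀ t : ℝ≥0,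
      ∫ x, ((∫ y, F y ∂(κ t x)) - ∫ z, F z ∂(wilsonMeasure (d := 3) (L := L) (fundamentalRep (Fin 2)) β')) ^ 2
          ∂(wilsonMeasure (d := 3) (L := L) (fundamentalRep (Fin 2)) β') ≤
        Real.exp (-2 * c * t) *
          ∫ x, (F x - ∫ z, F z ∂(wilsonMeasure (d := 3) (L := L) (fundamentalRep (Fin 2)) β')) ^ 2
            ∂(wilsonMeasure (d := 3) (L := L) (fundamentalRep (Fin 2)) β') :=
    fun F hF M hM t => integral_sq_transition_sub_le_exp_of_measurable L β' κ hreal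
      (fun G hG => (hgap κ hreal G hG t).2.2) hF hM
  refine ⟨hmeas, fun A hA t => ?_⟩
  have h1A : ∀ x : GaugeConfig 3 L (Matrix.specialUnitaryGroup (Fin 2) ℂ),
      |A.indicator (1 : GaugeConfig 3 L (Matrix.specialUnitaryGroup (Fin 2) ℂ) → ℝ) x| ≤ 1 := by
    intro x
    by_cases hx : x ∈ A
    · simp [Set.indicator_of_mem hx]
    · simp [Set.indicator_of_notMem hx]
  have h := hmeas (A.indicator (1 : GaugeConfig 3 L (Matrix.specialUnitaryGroup (Fin 2) ℂ) → ℝ))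
    (measurable_one.indicator hA) 1 h1A t
  have e1 : ∀ x, ∫ y, A.indicator (1 : GaugeConfig 3 L (Matrix.specialUnitaryGroup (Fin 2) ℂ) → ℝ) y ∂(κ t x) =
      (κ t x).real A := fun x => integral_indicator_one hA
  simp_rw [e1, integral_indicator_one hA, integral_indicator_sub_sq _ hA] at h
  exact h

end Summit.QuantumFields.YangMills.Theorems.ColdStartUniversality

end
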